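import Summits.QuantumAdvantage.AdviceFreeQNC0.BlockComb37
import Summits.QuantumAdvantage.AdviceFreeQNC0.PredHard
import HarnessLib

/-!
# Cell qa-qnc0 — P-37c (c3): (G₁) FOR EVERY GATE `everyGateHard` (4/4)

Cell qa-qnc0, crux stmt-QuantumAdvantage-22907.  AUTHORED AND PROVED BY THE PLANNER qa-qnc0-p1 gen 37 (P-37c (c2)+(c3), INBOX P1-37c 14:53Z, evidence #60 on stmt-22907, file `HOME/qa-qnc0-p1/exp37/BlockComb37.lean`, 1082 lines, sha db0f1086629d090a, rc 0 / 0 sorries); landed verbatim by qn-prover-3 g21 as a four-way split: `BlockComb37Fam` (§§0–3) → `BlockComb37Data` (§§4–5) → `BlockComb37` (§§6–8, ★ `blockComb_le`) → `BlockCombGate37` (§§9–10: the comb data `gateCD ℓ` of ONE gate — in each window of coefficients at 6k+2, 6k+3, 6k+4 two are equal or opposite; blindness `gateSum_cpl`; abundance `goodG_abundant` — and ★ `everyGateHard : EveryGateHard` = (G₁) for EVERY coefficient word ℓ, no hypothesis).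
-/

noncomputable section

open Classical

namespace Summit.QuantumAdvantage.AdviceFreeQNC0

open Finset
open Literature.Computability.MetaComplexity Literature.Computability.MetaComplexity.Smolensky
open F4 AffBells22 Subcube

namespace BlockFibre37

variable {n m : ℕ}
variable {K : ℕ}

/-! ### 9. (c3) The comb data of ONE gate: pairs of equal/opposite coefficients in every window of three -/

/-- coefficients at natural positions. -/
def ellN (ℓ : Fin (n + 1) → ZMod 3) (q : ℕ) : ZMod 3 := if h : q < n + 1 then ℓ ⟨q, h⟩ else 0

/-- equal or opposite. -/
def EqOpp (a b : ZMod 3) : Prop := a = b ∨ a + b = 0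

/-- among three elements of `𝔽₃` two are equal or opposite (= `Comb37J.three_window`). -/
theorem three_window (a b c : ZMod 3) : EqOpp a b ∨ EqOpp b c ∨ EqOpp a c := by
  unfold EqOpp; revert a b c; decide

/-- the head computation of the blindness lemma. -/
theorem head_cases : ∀ (la lb : ZMod 3) (xa xb : Bool), EqOpp la lb → (xa = xb ↔ la + lb = 0) →
    (if (!xa) = true then la else 0) + (if (!xb) = true then lb else 0)
      = (if xa = true then la else 0) + (if xb = true then lb else 0) := by
  unfold EqOpp; decide

/-- start of the chosen pair in the window `p, p+1, p+2`. -/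
def alpha (ℓ : Fin (n + 1) → ZMod 3) (p : ℕ) : ℕ :=
  if EqOpp (ellN ℓ p) (ellN ℓ (p + 1)) then p else if EqOpp (ellN ℓ (p + 1)) (ellN ℓ (p + 2)) then p + 1 else p

/-- distance of the chosen pair (`1` or `2`). -/
def lam (ℓ : Fin (n + 1) → ZMod 3) (p : ℕ) : ℕ :=
  if EqOpp (ellN ℓ p) (ellN ℓ (p + 1)) then 1 else if EqOpp (ellN ℓ (p + 1)) (ellN ℓ (p + 2)) then 1 else 2

/-- The chosen pair `(alpha, alpha + lam)` lies in the window `[p, p+2]`, has gap `1 ≤ lam ≤ 2`, and carries equal or opposite coefficients. -/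
theorem alpha_lam_spec (ℓ : Fin (n + 1) → ZMod 3) (p : ℕ) :
    p ≤ alpha ℓ p ∧ alpha ℓ p + lam ℓ p ≤ p + 2 ∧ 1 ≤ lam ℓ p ∧ lam ℓ p ≤ 2 ∧
      EqOpp (ellN ℓ (alpha ℓ p)) (ellN ℓ (alpha ℓ p + lam ℓ p)) := by
  unfold alpha lam
  by_cases h1 : EqOpp (ellN ℓ p) (ellN ℓ (p + 1))
  · rw [if_pos h1, if_pos h1]; exact ⟨le_rfl, by omega, le_rfl, by omega, h1⟩
  · rw [if_neg h1, if_neg h1]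
    by_cases h2 : EqOpp (ellN ℓ (p + 1)) (ellN ℓ (p + 2))
    · rw [if_pos h2, if_pos h2]; exact ⟨by omega, by omega, le_rfl, by omega, h2⟩
    · rw [if_neg h2, if_neg h2]
      refine ⟨le_rfl, by omega, by omega, le_rfl, ?_⟩
      rcases three_window (ellN ℓ p) (ellN ℓ (p + 1)) (ellN ℓ (p + 2)) with h | h | h
      · exact absurd h h1
      · exact absurd h h2
      · exact h

/-- number of blocks of the gate comb. -/
def KK (n : ℕ) : ℕ := n / 6 - 1

/-- Every comb index `k < KK n` has its window inside the ring: `6k + 12 ≤ n`. -/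
theorem bound_of_lt (k : Fin (KK n)) : 6 * k.val + 12 ≤ n := by
  have h := k.2; unfold KK at h; omega

/-- start / length of block `k` (inside the window `6k+2, 6k+3, 6k+4`). -/
def stG (ℓ : Fin (n + 1) → ZMod 3) (k : Fin (KK n)) : ℕ := alpha ℓ (6 * k.val + 2)
/-- length of block `k` (`1` or `2`). -/
def lenG (ℓ : Fin (n + 1) → ZMod 3) (k : Fin (KK n)) : ℕ := lam ℓ (6 * k.val + 2)

/-- Block `k` sits inside the window `6k+2 … 6k+4`, has length `1` or `2`, and its endpoints carry equal or opposite coefficients. -/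
theorem stG_spec (ℓ : Fin (n + 1) → ZMod 3) (k : Fin (KK n)) :
    6 * k.val + 2 ≤ stG ℓ k ∧ stG ℓ k + lenG ℓ k ≤ 6 * k.val + 4 ∧ 1 ≤ lenG ℓ k ∧ lenG ℓ k ≤ 2 ∧ 6 * k.val + 12 ≤ n ∧
      EqOpp (ellN ℓ (stG ℓ k)) (ellN ℓ (stG ℓ k + lenG ℓ k)) := by
  obtain ⟨h1, h2, h3, h4, h5⟩ := alpha_lam_spec ℓ (6 * k.val + 2)
  exact ⟨h1, h2, h3, h4, bound_of_lt k, h5⟩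

/-- the two boundary letters of block `k` as players' indices. -/
def aF (ℓ : Fin (n + 1) → ZMod 3) (k : Fin (KK n)) : Fin (n + 1) :=
  ⟨stG ℓ k, by obtain ⟨_, h2, _, _, h5, _⟩ := stG_spec ℓ k; omega⟩
/-- the right endpoint `stG + lenG` of block `k` as an index of `Fin (n+1)`. -/
def bF (ℓ : Fin (n + 1) → ZMod 3) (k : Fin (KK n)) : Fin (n + 1) :=
  ⟨stG ℓ k + lenG ℓ k, by obtain ⟨_, h2, _, _, h5, _⟩ := stG_spec ℓ k; omega⟩

/-- Value of the left endpoint index. -/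
theorem aF_val (ℓ : Fin (n + 1) → ZMod 3) (k : Fin (KK n)) : (aF ℓ k).val = stG ℓ k := rfl
/-- Value of the right endpoint index. -/
theorem bF_val (ℓ : Fin (n + 1) → ZMod 3) (k : Fin (KK n)) : (bF ℓ k).val = stG ℓ k + lenG ℓ k := rfl

/-- The ℕ-indexed coefficient at the left endpoint. -/
theorem ellN_aF (ℓ : Fin (n + 1) → ZMod 3) (k : Fin (KK n)) : ellN ℓ (stG ℓ k) = ℓ (aF ℓ k) := by
  unfold ellN; rw [dif_pos (show stG ℓ k < n + 1 from (aF ℓ k).2)]; rfl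
/-- The ℕ-indexed coefficient at the right endpoint. -/
theorem ellN_bF (ℓ : Fin (n + 1) → ZMod 3) (k : Fin (KK n)) : ellN ℓ (stG ℓ k + lenG ℓ k) = ℓ (bF ℓ k) := by
  unfold ellN; rw [dif_pos (show stG ℓ k + lenG ℓ k < n + 1 from (bF ℓ k).2)]; rfl

/-- the block family of the gate. -/
def gateFam (ℓ : Fin (n + 1) → ZMod 3) : BlockFam n (KK n) where
  st k := stG ℓ k
  len k := lenG ℓ k
  len_pos k := (stG_spec ℓ k).2.2.1
  one_le k := by have := (stG_spec ℓ k).1; omega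
  le_n k := by obtain ⟨_, h2, _, _, h5, _⟩ := stG_spec ℓ k; omega
  sep k k' h := by
    have h1 := (stG_spec ℓ k).2.1
    have h2 := (stG_spec ℓ k').1
    have : k.val < k'.val := h
    omega

/-- Start of block `k` of the gate family. -/
theorem gateFam_st (ℓ : Fin (n + 1) → ZMod 3) (k : Fin (KK n)) : (gateFam ℓ).st k = stG ℓ k := rfl
/-- Length of block `k` of the gate family. -/
theorem gateFam_len (ℓ : Fin (n + 1) → ZMod 3) (k : Fin (KK n)) : (gateFam ℓ).len k = lenG ℓ k := rfl
/-- Membership in block `k` of the gate family. -/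
theorem inBlock_gateFam (ℓ : Fin (n + 1) → ZMod 3) (k : Fin (KK n)) (i : Fin n) :
    InBlock (gateFam ℓ) k i ↔ stG ℓ k ≤ i.val ∧ i.val < stG ℓ k + lenG ℓ k := Iff.rfl

/-- the coefficient relation of block `k`: opposite coefficients. -/
def OppC (ℓ : Fin (n + 1) → ZMod 3) (k : Fin (KK n)) : Prop := ℓ (aF ℓ k) + ℓ (bF ℓ k) = 0

/-- the boundary letters stand in the right relation (equal iff the coefficients are opposite). -/
def RelOK (ℓ : Fin (n + 1) → ZMod 3) (k : Fin (KK n)) (u : Fin n → Bool) : Prop :=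
  (xOfU u (aF ℓ k) = xOfU u (bF ℓ k) ↔ OppC ℓ k)

/-- goodness of block `k`: right relation and admissible. -/
def GoodG (ℓ : Fin (n + 1) → ZMod 3) (k : Fin (KK n)) (u : Fin n → Bool) : Prop :=
  RelOK ℓ k u ∧ Admissible (gateFam ℓ) u k

/-- **blindness**: complementing a good block does not change the value of the gate. -/
theorem gateSum_cpl (ℓ : Fin (n + 1) → ZMod 3) (k : Fin (KK n)) (u : Fin n → Bool) (hg : GoodG ℓ k u) :
    gateSum ℓ (cpl (gateFam ℓ) k u) = gateSum ℓ u := by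
  obtain ⟨hs1, hs2, hl1, hl2, hn, heo⟩ := stG_spec ℓ k
  rw [cpl_eq_blockCompl, gateFam_st, gateFam_len]
  have hab : stG ℓ k < stG ℓ k + lenG ℓ k := by omega
  have hbn : stG ℓ k + lenG ℓ k ≤ n := by omega
  have hxa : xOfU (Comb37.blockCompl u (stG ℓ k) (stG ℓ k + lenG ℓ k)) (aF ℓ k) = !xOfU u (aF ℓ k) :=
    Comb37.xOfU_blockCompl_left u hab hbn (aF_val ℓ k)
  have hxb : xOfU (Comb37.blockCompl u (stG ℓ k) (stG ℓ k + lenG ℓ k)) (bF ℓ k) = !xOfU u (bF ℓ k) :=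
    Comb37.xOfU_blockCompl_right u hab hbn (bF_val ℓ k)
  have hxo : ∀ i : Fin (n + 1), i ≠ aF ℓ k → i ≠ bF ℓ k →
      xOfU (Comb37.blockCompl u (stG ℓ k) (stG ℓ k + lenG ℓ k)) i = xOfU u i := by
    intro i h1 h2
    refine Comb37.xOfU_blockCompl_of_ne u hbn ?_ ?_
    · intro h; exact h1 (Fin.ext (by rw [aF_val]; exact h))
    · intro h; exact h2 (Fin.ext (by rw [bF_val]; exact h))
  have hne : aF ℓ k ≠ bF ℓ k := by
    intro h; have := congrArg Fin.val h; rw [aF_val, bF_val] at this; omega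
  unfold gateSum
  rw [sum_pair_rest hne, sum_pair_rest hne]
  have hrest : ∑ i ∈ (univ.erase (aF ℓ k)).erase (bF ℓ k),
      (if xOfU (Comb37.blockCompl u (stG ℓ k) (stG ℓ k + lenG ℓ k)) i = true then ℓ i else 0)
      = ∑ i ∈ (univ.erase (aF ℓ k)).erase (bF ℓ k), (if xOfU u i = true then ℓ i else 0) := by
    refine sum_congr rfl fun i hi => ?_
    have h2 : i ≠ bF ℓ k := (mem_erase.1 hi).1
    have h1 : i ≠ aF ℓ k := (mem_erase.1 (mem_erase.1 hi).2).1
    rw [hxo i h1 h2]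
  have heo' : EqOpp (ℓ (aF ℓ k)) (ℓ (bF ℓ k)) := by
    have h := heo; rw [ellN_aF, ellN_bF] at h; exact h
  have hh := head_cases (ℓ (aF ℓ k)) (ℓ (bF ℓ k)) (xOfU u (aF ℓ k)) (xOfU u (bF ℓ k)) heo' hg.1
  rw [hrest, hxa, hxb, hh]

/-- The relation predicate `RelOK` is invariant under the own-block complement. -/
theorem relOK_cpl (ℓ : Fin (n + 1) → ZMod 3) (k : Fin (KK n)) (u : Fin n → Bool) :
    RelOK ℓ k (cpl (gateFam ℓ) k u) ↔ RelOK ℓ k u := by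
  obtain ⟨hs1, hs2, hl1, hl2, hn, -⟩ := stG_spec ℓ k
  rw [cpl_eq_blockCompl, gateFam_st, gateFam_len]
  have hab : stG ℓ k < stG ℓ k + lenG ℓ k := by omega
  have hbn : stG ℓ k + lenG ℓ k ≤ n := by omega
  unfold RelOK
  rw [Comb37.xOfU_blockCompl_left u hab hbn (aF_val ℓ k), Comb37.xOfU_blockCompl_right u hab hbn (bF_val ℓ k)]
  cases xOfU u (aF ℓ k) <;> cases xOfU u (bF ℓ k) <;> simp

/-- Goodness `GoodG` is invariant under the own-block complement. -/
theorem goodG_cpl (ℓ : Fin (n + 1) → ZMod 3) (k : Fin (KK n)) (u : Fin n → Bool) (hg : GoodG ℓ k u) :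
    GoodG ℓ k (cpl (gateFam ℓ) k u) := by
  refine ⟨(relOK_cpl ℓ k u).2 hg.1, ?_⟩
  have h := bwt_cpl (gateFam ℓ) k u
  have h2 := hg.2
  unfold Admissible at h2 ⊢
  omega

/-- Goodness of block `k` depends only on the input bits `6k+1 … 6k+4`. -/
theorem goodG_local (ℓ : Fin (n + 1) → ZMod 3) (k : Fin (KK n)) (u u' : Fin n → Bool)
    (h : ∀ i : Fin n, 6 * k.val + 1 ≤ i.val → i.val ≤ 6 * k.val + 4 → u i = u' i) (hg : GoodG ℓ k u) :
    GoodG ℓ k u' := by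
  obtain ⟨hs1, hs2, hl1, hl2, hn, -⟩ := stG_spec ℓ k
  have hU : ∀ q, 6 * k.val + 1 ≤ q → q ≤ 6 * k.val + 4 → uExt u q = uExt u' q := by
    intro q h1 h2
    exact uExt_congr (by omega) (h _ h1 h2)
  have ha : xOfU u (aF ℓ k) = xOfU u' (aF ℓ k) :=
    xOfU_congr (aF ℓ k) (hU _ (by rw [aF_val]; omega) (by rw [aF_val]; omega))
      (hU _ (by rw [aF_val]; omega) (by rw [aF_val]; omega))
  have hb : xOfU u (bF ℓ k) = xOfU u' (bF ℓ k) :=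
    xOfU_congr (bF ℓ k) (hU _ (by rw [bF_val]; omega) (by rw [bF_val]; omega))
      (hU _ (by rw [bF_val]; omega) (by rw [bF_val]; omega))
  have hw : bwt (gateFam ℓ) u k = bwt (gateFam ℓ) u' k :=
    bwt_congr (gateFam ℓ) k fun i hi => by
      rw [inBlock_gateFam] at hi
      exact h i (by omega) (by omega)
  refine ⟨?_, ?_⟩
  · have h1 := hg.1; unfold RelOK at h1 ⊢; rw [← ha, ← hb]; exact h1
  · have h2 := hg.2; unfold Admissible at h2 ⊢; rw [← hw]; exact h2

/-- Flipping the bit at the right endpoint `β` toggles `RelOK`. -/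
theorem relOK_flipN_beta (ℓ : Fin (n + 1) → ZMod 3) (k : Fin (KK n)) (u : Fin n → Bool) :
    RelOK ℓ k (flipN (stG ℓ k + lenG ℓ k) u) ↔ ¬ RelOK ℓ k u := by
  obtain ⟨hs1, hs2, hl1, hl2, hn, -⟩ := stG_spec ℓ k
  unfold RelOK
  rw [xOfU_flipN_of_ne _ u (by rw [aF_val]; omega) (by rw [aF_val]; omega),
    xOfU_flipN_self _ u (by omega) (bF_val ℓ k)]
  cases xOfU u (aF ℓ k) <;> cases xOfU u (bF ℓ k) <;> simp

/-- Flipping the bit at `β` preserves admissibility of block `k`. -/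
theorem adm_flipN_beta (ℓ : Fin (n + 1) → ZMod 3) (k : Fin (KK n)) (u : Fin n → Bool) :
    Admissible (gateFam ℓ) (flipN (stG ℓ k + lenG ℓ k) u) k ↔ Admissible (gateFam ℓ) u k := by
  unfold Admissible
  rw [bwt_congr (gateFam ℓ) k (u := flipN (stG ℓ k + lenG ℓ k) u) (u' := u) fun i hi => by
    rw [inBlock_gateFam] at hi
    exact flipN_apply_of_ne _ u (by omega)]

/-- A block of length `1` is always admissible. -/
theorem adm_of_len_one (ℓ : Fin (n + 1) → ZMod 3) (k : Fin (KK n)) (h1 : lenG ℓ k = 1) (u : Fin n → Bool) :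
    Admissible (gateFam ℓ) u k := by
  have ha : lenG ℓ k ≤ bwt (gateFam ℓ) u k := Nat.le_add_right _ _
  have hb := bwt_le_two_len (gateFam ℓ) u k
  rw [gateFam_len] at hb
  unfold Admissible
  omega

/-- For a block of length `2`, flipping the bit at `β − 1` toggles admissibility. -/
theorem adm_flipN_len_two (ℓ : Fin (n + 1) → ZMod 3) (k : Fin (KK n)) (h2 : lenG ℓ k = 2) (u : Fin n → Bool) :
    Admissible (gateFam ℓ) (flipN (stG ℓ k + lenG ℓ k - 1) u) k ↔ ¬ Admissible (gateFam ℓ) u k := by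
  obtain ⟨hs1, hs2, hl1, hl2, hn, -⟩ := stG_spec ℓ k
  have hlt : stG ℓ k + 1 < n := by omega
  have hin : InBlock (gateFam ℓ) k ⟨stG ℓ k + 1, hlt⟩ := by
    rw [inBlock_gateFam]
    show stG ℓ k ≤ stG ℓ k + 1 ∧ stG ℓ k + 1 < stG ℓ k + lenG ℓ k
    omega
  have e : stG ℓ k + lenG ℓ k - 1 = stG ℓ k + 1 := by omega
  rw [e]
  have key : bwt (gateFam ℓ) (flipN (stG ℓ k + 1) u) k + (if u ⟨stG ℓ k + 1, hlt⟩ = true then 2 else 1)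
      = bwt (gateFam ℓ) u k + (if (!u ⟨stG ℓ k + 1, hlt⟩) = true then 2 else 1) :=
    bwt_flipN_mem (gateFam ℓ) u hin
  have ha : lenG ℓ k ≤ bwt (gateFam ℓ) u k := Nat.le_add_right _ _
  have hb := bwt_le_two_len (gateFam ℓ) u k
  have ha' : lenG ℓ k ≤ bwt (gateFam ℓ) (flipN (stG ℓ k + 1) u) k := Nat.le_add_right _ _
  have hb' := bwt_le_two_len (gateFam ℓ) (flipN (stG ℓ k + 1) u) k
  rw [gateFam_len] at hb hb'
  unfold Admissible
  cases hu : u ⟨stG ℓ k + 1, hlt⟩ <;> simp [hu] at key <;> omega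

/-- **abundance**: from every input, flipping the bits `β − 1` and/or `β` reaches a good one. -/
theorem goodG_abundant (ℓ : Fin (n + 1) → ZMod 3) (k : Fin (KK n)) (u : Fin n → Bool) :
    ∃ s t : Bool, GoodG ℓ k (flipB t (stG ℓ k + lenG ℓ k) (flipB s (stG ℓ k + lenG ℓ k - 1) u)) := by
  obtain ⟨hs1, hs2, hl1, hl2, hn, -⟩ := stG_spec ℓ k
  have step1 : ∃ s : Bool, Admissible (gateFam ℓ) (flipB s (stG ℓ k + lenG ℓ k - 1) u) k := by
    rcases (show lenG ℓ k = 1 ∨ lenG ℓ k = 2 by omega) with h1 | h2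
    · exact ⟨false, by rw [flipB_false]; exact adm_of_len_one ℓ k h1 u⟩
    · by_cases hadm : Admissible (gateFam ℓ) u k
      · exact ⟨false, by rw [flipB_false]; exact hadm⟩
      · exact ⟨true, by rw [flipB_true]; exact (adm_flipN_len_two ℓ k h2 u).2 hadm⟩
  obtain ⟨s, hs⟩ := step1
  by_cases hrel : RelOK ℓ k (flipB s (stG ℓ k + lenG ℓ k - 1) u)
  · exact ⟨s, false, by rw [flipB_false]; exact ⟨hrel, hs⟩⟩
  · refine ⟨s, true, ?_⟩
    rw [flipB_true]
    exact ⟨(relOK_flipN_beta ℓ k _).2 hrel, (adm_flipN_beta ℓ k _).2 hs⟩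

/-- **the comb data of the gate `ℓ`.** -/
def gateCD (ℓ : Fin (n + 1) → ZMod 3) : CombData n (KK n) where
  fam := gateFam ℓ
  lo k := 6 * k.val + 1
  hi k := 6 * k.val + 4
  lo_le k := by have := (stG_spec ℓ k).1; show 6 * k.val + 1 + 1 ≤ stG ℓ k; omega
  le_hi k := by have := (stG_spec ℓ k).2.1; show stG ℓ k + lenG ℓ k ≤ 6 * k.val + 4; omega
  hi_lt k := by have := bound_of_lt k; omega
  disj k k' h := by have : k.val < k'.val := h; omega
  Good k u := GoodG ℓ k u
  good_local k u u' h hg := goodG_local ℓ k u u' h hg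
  good_cpl k u hg := goodG_cpl ℓ k u hg
  good_adm k u hg := hg.2
  pc k := stG ℓ k + lenG ℓ k - 1
  pd k := stG ℓ k + lenG ℓ k
  pc_mem k := by obtain ⟨h1, h2, h3, _⟩ := stG_spec ℓ k; omega
  pd_mem k := by obtain ⟨h1, h2, h3, _⟩ := stG_spec ℓ k; omega
  abundant k u := goodG_abundant ℓ k u

/-! ### 10. (c3) (G₁) FOR EVERY GATE -/

/-- **(G₁) for every gate.** -/
theorem everyGateHard : EveryGateHard := by
  obtain ⟨θ, hθ, hmain⟩ := blockComb_le
  refine ⟨θ, hθ, fun C => ?_⟩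
  obtain ⟨A, n₀, hA⟩ := hmain C
  obtain ⟨n₁, hn₁⟩ := DWalk.const_mul_logPow_le' (6 * A + 12) (2 * C + 1)
  refine ⟨max (max n₀ n₁) 2, fun n hn ℓ c T f G hloc => ?_⟩
  have hn0 : n₀ ≤ n := le_trans (le_trans (le_max_left _ _) (le_max_left _ _)) hn
  have hn1 : n₁ ≤ n := le_trans (le_trans (le_max_right _ _) (le_max_left _ _)) hn
  have hn2 : 2 ≤ n := le_trans (le_max_right _ _) hn
  have hL1 : 1 ≤ Nat.log 2 n := Nat.le_log_of_pow_le (by norm_num) (by simpa using hn2)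
  have hK : A * (Nat.log 2 n) ^ (2 * C + 1) ≤ KK n := by
    have h := hn₁ n hn1
    have hL : 1 ≤ (Nat.log 2 n) ^ (2 * C + 1) := Nat.one_le_pow _ _ hL1
    unfold KK
    generalize (Nat.log 2 n) ^ (2 * C + 1) = P at h hL ⊢
    have h' : 6 * (A * P) + 12 ≤ n := by nlinarith
    omega
  exact hA n hn0 (KK n) (gateCD ℓ) hK c T (fun u => f (gateSum ℓ u)) G
    (fun u k hk => congrArg f (gateSum_cpl ℓ k u hk)) hloc

end BlockFibre37

end Summit.QuantumAdvantage.AdviceFreeQNC0
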